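import Summits.AtomisticToContinuum.HydrodynamicLimit.Theses.OneFlightGossipEngine
import Summits.AtomisticToContinuum.HydrodynamicLimit.Theses.TwoClocks
import Summits.AtomisticToContinuum.HydrodynamicLimit.Theorems.TwoClocksEquilibriumClampedCollisionalWindowLDRefutation

/-!
# Record of dropped route items of `OneFlightGossipEngine` / `TwoClocks` (2026-08-16 repairs)

The route repairs of 2026-08-16T20:17Z (`TwoClocks`) and 2026-08-16T20:36–23:24Z (`OneFlightGossipEngine`,
revs 25–29) DROPPED from the two gate-written route files of sub-problem
`AtomisticToContinuum/HydrodynamicLimit` the constants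

* `TwoClocks.CollisionActivityTails` — the shared crux stmt-AtomisticToContinuum-13734 (a-priori `L¹` tails
  of the window collisional activity), restated in `TwoClocks` as stmt-16624 (still declared, verbatim, by
  `OneFlightGossipEngine`);
* `OneFlightGossipEngine.ClampedCurrentsDock` — the dock stmt-AtomisticToContinuum-14680
  (`KineticCurrentsWindowLDUniform → EquilibriumClampedCollisionalWindowLD → CollisionActivityTails →
  EnergyCurrentTails → DiluteSelfConsistency → HydrodynamicLimit`), replaced by `ClampedTransferDock`;
* `OneFlightGossipEngine.Assembly` AS OF REV 21 — the frame stmt-AtomisticToContinuum-14647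
  (`OneFlightLayeredChaos → ClampedCurrentsDock` spelled out), restated UNDER THE SAME NAME (revs 25, 29:
  stmt-16666, stmt-17616), so its old reading can only be recorded under a new name, `AssemblyStmt14647`;

besides the shared refuted crux `EquilibriumClampedCollisionalWindowLD` (stmt-13733), whose two readings are
recorded by `Theorems/TwoClocksEquilibriumClampedCollisionalWindowLDRefutation.lean` (p135194), imported here
because the dock's signature names it.

Append-only Theorems files of the sub-problem that name these constants (the reductions file
`Theorems/OneFlightGossipEngineAssembly.lean`, the `ClampedCurrentsDock*` line files) stopped building
("Unknown identifier", full builds of 2026-08-16/17). This module re-declares them under their ORIGINAL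
fully-qualified names (the old `Assembly` under `AssemblyStmt14647`), each with its item's ledger signature
VERBATIM as definiens, in the route files' namespaces and `open` context, so that those records elaborate
again with one added `import` line (pattern
`Summits/KontsevichZagierPeriods/…/Theorems/SymplecticScissorsCurvePeriodsTransferRecord.lean`). None of
them is a route item (no `route_item` attribute), none is a literature fact; they are records of what was
filed. NB: since stmt-13733 is refuted, the recorded dock `ClampedCurrentsDock` holds VACUOUSLY
(`Theorems.oneFlightGossipEngine_clampedCurrentsDock_vacuous` in `OneFlightGossipEngineAssembly.lean`).
-/

namespace Summit.AtomisticToContinuum.HydrodynamicLimit.Theses.OneFlightGossipEngine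

open scoped BigOperators Topology Manifold Classical MeasureTheory ProbabilityTheory Matrix InnerProductSpace ComplexConjugate ContinuousMap
open Filter Set Function TopologicalSpace MeasureTheory

/-- The dock `ClampedCurrentsDock` of route `OneFlightGossipEngine` as declared until 2026-08-16T20:36Z (item
stmt-AtomisticToContinuum-14680, ledger signature verbatim): the restricted-class kinetic window node, the clamped
collisional window node (stmt-13733, refuted — so this implication holds vacuously), the activity and
energy-current tails and dilute self-consistency imply the sub-problem Statement. Record only (not a route item;
the live dock is `ClampedTransferDock`). -/
def ClampedCurrentsDock : Prop :=
  KineticCurrentsWindowLDUniform → EquilibriumClampedCollisionalWindowLD → CollisionActivityTails → EnergyCurrentTails → DiluteSelfConsistency → _root_.HydrodynamicLimit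

/-- The frame `Assembly` of route `OneFlightGossipEngine` AS OF REV 21 (item stmt-AtomisticToContinuum-14647,
ledger signature verbatim): `OneFlightLayeredChaos → ClampedCurrentsDock`, spelled out. The route decl `Assembly`
was restated under the same name (stmt-16666, then stmt-17616), so this reading is recorded under a new name.
Record only (not a route item). -/
def AssemblyStmt14647 : Prop :=
  OneFlightLayeredChaos → KineticCurrentsWindowLDUniform → EquilibriumClampedCollisionalWindowLD → CollisionActivityTails → EnergyCurrentTails → DiluteSelfConsistency → _root_.HydrodynamicLimit

end Summit.AtomisticToContinuum.HydrodynamicLimit.Theses.OneFlightGossipEngine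

namespace Summit.AtomisticToContinuum.HydrodynamicLimit.Theses.TwoClocks

open scoped BigOperators Topology Manifold Classical MeasureTheory ProbabilityTheory Matrix InnerProductSpace ComplexConjugate ContinuousMap
open Filter Set Function TopologicalSpace MeasureTheory

/-- `CollisionActivityTails` as route `TwoClocks` declared it until 2026-08-16T20:17Z (shared crux
stmt-AtomisticToContinuum-13734, ledger signature verbatim; restated in `TwoClocks` as stmt-16624, still declared
verbatim by `OneFlightGossipEngine`): a-priori `L¹` tails, uniform in `N`, of the window-averaged collisional
activity of a tagged sphere under the evolved local Gibbs law along a classical hard-sphere Euler solution.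
Record only (not a route item). -/
def CollisionActivityTails : Prop :=
  ∀ (a₀ θ₀ : Literature.MathematicalPhysics.KineticTheory.T3 → ℝ) (u₀ : Literature.MathematicalPhysics.KineticTheory.T3 → Literature.MathematicalPhysics.KineticTheory.V3), Continuous a₀ → Continuous θ₀ → Continuous u₀ → (∀ x, 0 < a₀ x) → (∀ x, 0 < θ₀ x) → ∃ σ₀ : ℝ, 0 < σ₀ ∧ ∀ σ : ℝ, 0 < σ → σ < σ₀ → ∀ (T : ℝ) (ρ θ : ℝ → Literature.MathematicalPhysics.KineticTheory.T3 → ℝ) (u : ℝ → Literature.MathematicalPhysics.KineticTheory.T3 → Literature.MathematicalPhysics.KineticTheory.V3), Literature.MathematicalPhysics.KineticTheory.IsHardSphereEulerSolution σ T ρ u θ → ∀ Φ : (N : ℕ) → Literature.Analysis.FluidPDE.HardSphereFlow (Literature.Analysis.FluidPDE.Torus.geometry (Fin 3)) (Literature.MathematicalPhysics.KineticTheory.hsDiameter σ N) (N + 1), Literature.MathematicalPhysics.KineticTheory.TendstoHydroFieldsAt (fun N => Literature.MathematicalPhysics.KineticTheory.localGibbsLaw σ a₀ u₀ θ₀ N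 (Φ N)) Φ ρ u θ 0 → ∀ t ∈ Set.Ico 0 T, ∃ V₀ : ℝ, 0 < V₀ ∧ ∀ V : ℝ, V₀ ≤ V → ∀ ε : ℝ, 0 < ε → ∃ τ₀ : ℝ, 0 < τ₀ ∧ ∀ τ : ℝ, τ₀ ≤ τ → ∃ N₀ : ℕ, ∀ N : ℕ, N₀ ≤ N → ∀ s ∈ Set.Icc 0 t, (let w : ℝ := τ * ((N : ℝ) + 1) ^ (-(1 / 3 : ℝ)); let P := Literature.MathematicalPhysics.KineticTheory.localGibbsLaw σ a₀ u₀ θ₀ N (Φ N); let act := fun (i : Fin (N + 1)) (z : Literature.Analysis.FluidPDE.Config (N + 1) (Fin 3) Literature.MathematicalPhysics.KineticTheory.T3) => σ / τ * (Φ N).collisionSum (Set.Ioc s (s + w)) (fun c => if c.fst = i then ‖c.postVel.1 - c.preVel.1‖ else 0) z; ∫⁻ z, ENNReal.ofReal (((N : ℝ) + 1)⁻¹ * ∑ i : Fin (N + 1), Set.indicator {y : ℝ | V < y} (fun y => y) (act i z)) ∂P ≤ ENNReal.ofReal ε)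

end Summit.AtomisticToContinuum.HydrodynamicLimit.Theses.TwoClocks
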